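import Summits.QuantumFields.QCD.Theorems.QuarksAsStableActionStableActionBridgeStubCyclicScalarise
import HarnessLib

/-!
# Stub `stub_cyclic_scalarise_insert` of line `pin-the-infimum` (crux `RobustYangMillsHandover`, item 8892)

E2 (fermionic insertions in Lüscher's transfer form), layer δ1 (lead c16, wave 6): **scalarising the
configuration-space cyclic supertrace in the presence of fibrewise slot insertions** — the port of
sub-goal B5 of crux 9737 (`stub_cyclic_scalarise`, supertrace clause) with one extra link-free Fock
matrix `Q_i(U_i)` (continuous in the slice-`i` spatial links, commuting with the fermion parity
`Π = diag((−1)^{#s})`) in front of each slot of the word: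
`∫∫ ∏_t K_β(U_t, U_{t+1}^{g_t}) · STr ∏_i [Q_i(U_i) T̂_F(U_i) Γ(G_{g_i})] dU dg`
`  = ∫ (−1)^{#(V 0).2} ∏_{t : Fin N} (R(U_t) B(U_t,U_{t+1}) Q_{t+1}(U_{t+1}) R(U_{t+1}))_{s_t s_{t+1}} d(Haar ⊗ count)^{⊗N}(V)`
(`V t = (U_t, s_t)`, indices mod `N`; `R(U)² = T̂_F(U)` any continuous pointwise square root commuting
with `Π`; `B(U,U')_{a c} = ∫ K_β(U, U'^g) Γ(G_g)_{a c} dg` the Gauss-averaged bond matrix): the insertion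
in front of slice `i` lands INSIDE the bond kernel entering slice `i`, between `B` and `R`.

Proof (the template's, with a time-dependent right factor).  `N = n + 1`, `ZMod (n+1) = Fin (n+1)`
definitionally, `(List.range N).map … = List.ofFn …`, `T̂_F = R R`.  Algebra at fixed `(U, g)`: with
`a_t = Q_t R_t`, `b_t = R_t Γ_t` the word is `∏_t a_t b_t`; since `[diag w, a₀] = 0` (both `Q₀` and
`R₀` commute with the parity) cyclicity of the trace moves `a₀` to the end,
`Tr[D ∏_t a_t b_t] = Tr[D ∏_t b_t a_{t+1}]` (`sum_cyclic_shift`), i.e. the word regroups as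
`∏_t [R_t Γ_t (Q_{t+1} R_{t+1})]`, and the weighted trace is the cyclic path sum (the template's
`sum_mul_listProd_apply_eq_sum_cyclic`).  Each temporal link enters exactly one bond, so the Haar
integral over `g` factorises (`integral_fintype_prod_eq_prod`) and the constant matrices `R_t` (left)
and `Q_{t+1} R_{t+1}` (right) come out of the entrywise bond average (the template's
`integral_mul_three_apply`).  Measures exactly as in the template: Fubini over `(U, g)` on the left
(continuous integrand on a compact space); `(Fin N → X × F) ≃ (Fin N → X) × (Fin N → F)`
(`measurePreserving_arrowProdEquivProdArrow`), Fubini and `pi count = count` on the right; integrability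
of the right-hand integrand as the `g`-integral of a continuous function.  The analysis is done for
abstract compact slice/link spaces and a time-dependent insertion `Q : Fin (n+1) → X → Matrix F F ℂ`,
instantiated at the end with `Q t := Q (t : ℕ)` (so the insertion at bond `t` carries the index of the
TARGET slice `((t + 1 : Fin N) : ℕ)`, `= 0` for the last bond).  Pure theorem file; helpers in the
sub-namespace `StubCyclicScalariseInsert`.

References: M. Lüscher, Commun. Math. Phys. 54 (1977) 283 [Luscher1977, pp. 283–292]; I. Montvay,
G. Münster, *Quantum Fields on a Lattice* (CUP 1994) [MontvayMunster1994, §4.1.3 (4.34)].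
-/

noncomputable section

namespace Summit.QuantumFields.QCD.Cruxes.RobustYangMillsHandover.PinTheInfimum

open MeasureTheory
open scoped Matrix BigOperators
open Literature.MathematicalPhysics.QuantumFieldTheory Literature.MathematicalPhysics.QuantumLattice
open Literature.Probability.LatticeModels (TorusSite)
open Summit.QuantumFields.QCD.Cruxes.StableActionBridge.TwistedTraceTransfer

namespace StubCyclicScalariseInsert

open StubCyclicScalarise

/-! ### Algebra: cyclic shift of a two-letter word under a weighted trace -/

/-- Shift lemma for an open two-letter chain: `a₀ · ∏ᵢ (bᵢ aᵢ₊₁) = ∏ᵢ (aᵢ bᵢ) · a_m` (pure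
reassociation). [folklore] -/
theorem mul_listProd_chain₂ {M : Type*} [Monoid M] (m : ℕ) (a b : Fin (m + 1) → M) :
    a 0 * (List.ofFn fun i : Fin m => b i.castSucc * a i.succ).prod =
      (List.ofFn fun i : Fin m => a i.castSucc * b i.castSucc).prod * a (Fin.last m) := by
  -- adapted from `StubCyclicScalarise.mul_listProd_chain` (one-letter version)
  induction m with
  | zero => simp
  | succ m ih =>
    have h := ih (fun j => a j.succ) (fun j => b j.succ)
    simp only [Fin.succ_zero_eq_one, Fin.succ_castSucc, Fin.succ_last, Nat.succ_eq_add_one] at h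
    rw [List.ofFn_succ, List.ofFn_succ, List.prod_cons, List.prod_cons]
    simp only [Fin.castSucc_zero, Fin.succ_zero_eq_one]
    rw [show a 0 * (b 0 * a 1 * (List.ofFn fun i : Fin m => b i.succ.castSucc * a i.succ.succ).prod) =
        a 0 * b 0 * (a 1 * (List.ofFn fun i : Fin m => b i.succ.castSucc * a i.succ.succ).prod) by
      simp only [mul_assoc], h]
    simp only [mul_assoc]

variable {F : Type*} [Fintype F] [DecidableEq F]

/-- **Cyclic shift under a weighted trace**: if `diag w` commutes with `a₀` then
`Σ_s w_s (∏_t a_t b_t)_{ss} = Σ_p w(p₀) ∏_t (b_t a_{t+1})_{p_t p_{t+1}}` (indices mod `n + 1`), i.e.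
`Tr[D (a₀b₀)(a₁b₁)⋯(a_n b_n)] = Tr[D (b₀a₁)(b₁a₂)⋯(b_n a₀)]` by cyclicity. [cite: Luscher1977, pp. 283–292] -/
theorem sum_cyclic_shift (n : ℕ) (w : F → ℂ) (a b : Fin (n + 1) → Matrix F F ℂ)
    (hw : Matrix.diagonal w * a 0 = a 0 * Matrix.diagonal w) :
    ∑ s, w s * (List.ofFn fun t => a t * b t).prod s s =
      ∑ p : Fin (n + 1) → F, w (p 0) * ∏ t, (b t * a (t + 1)) (p t) (p (t + 1)) := by
  -- adapted from `StubCyclicScalarise.sum_cyclic_regroup`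
  rw [← sum_mul_listProd_apply_eq_sum_cyclic]
  have key : ∀ L : Matrix F F ℂ, ∑ s, w s * L s s = (Matrix.diagonal w * L).trace := fun L => by
    rw [Matrix.trace]; simp only [Matrix.diag_apply, Matrix.diagonal_mul]
  rw [key, key, List.ofFn_succ' (f := fun t => a t * b t),
    List.ofFn_succ' (f := fun t => b t * a (t + 1)), List.prod_concat, List.prod_concat]
  simp only [Fin.coeSucc_eq_succ, Fin.last_add_one]
  have hshift := mul_listProd_chain₂ n a b
  symm
  calc (Matrix.diagonal w * ((List.ofFn fun i : Fin n => b i.castSucc * a i.succ).prod *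
          (b (Fin.last n) * a 0))).trace
      = ((Matrix.diagonal w * ((List.ofFn fun i : Fin n => b i.castSucc * a i.succ).prod *
          b (Fin.last n))) * a 0).trace := by simp only [Matrix.mul_assoc]
    _ = (a 0 * (Matrix.diagonal w * ((List.ofFn fun i : Fin n => b i.castSucc * a i.succ).prod *
          b (Fin.last n)))).trace := Matrix.trace_mul_comm _ _
    _ = (Matrix.diagonal w * ((a 0 * (List.ofFn fun i : Fin n => b i.castSucc * a i.succ).prod) *
          b (Fin.last n))).trace := by
        rw [← Matrix.mul_assoc (a 0), ← hw]; simp only [Matrix.mul_assoc]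
    _ = _ := by rw [hshift]; simp only [Matrix.mul_assoc]

/-- **Cyclic regrouping with insertions**: if `diag w` commutes with `q₀` and with `r₀` then
`Σ_s w_s (∏_t q_t (r_t r_t y_t))_{ss} = Σ_p w(p₀) ∏_t (r_t y_t (q_{t+1} r_{t+1}))_{p_t p_{t+1}}`
(`sum_cyclic_shift` with `a_t = q_t r_t`, `b_t = r_t y_t`). [cite: Luscher1977, pp. 283–292] -/
theorem sum_cyclic_regroup_insert (n : ℕ) (w : F → ℂ) (q r y : Fin (n + 1) → Matrix F F ℂ)
    (hq : Matrix.diagonal w * q 0 = q 0 * Matrix.diagonal w)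
    (hr : Matrix.diagonal w * r 0 = r 0 * Matrix.diagonal w) :
    ∑ s, w s * (List.ofFn fun t => q t * (r t * r t * y t)).prod s s =
      ∑ p : Fin (n + 1) → F, w (p 0) * ∏ t, (r t * y t * (q (t + 1) * r (t + 1))) (p t) (p (t + 1)) := by
  have h := sum_cyclic_shift n w (fun t => q t * r t) (fun t => r t * y t)
    (by rw [← Matrix.mul_assoc, hq, Matrix.mul_assoc, hr, Matrix.mul_assoc])
  simp only [Matrix.mul_assoc] at h ⊢
  exact h

/-! ### Abstract slice data (`X` slices, `Gt` temporal links, `F` Fock indices, bond kernel `K`,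
action `act` of `Gt` on `X`, Fock rotation `Γ`, square root `R`, slot insertions `Q t`, weight `w`) -/

section Abstract

variable {X Gt P : Type*} [TopologicalSpace X] [TopologicalSpace Gt] [TopologicalSpace P]
  (K : X → X → ℝ) (act : Gt → X → X) (Γ : Gt → Matrix F F ℂ) (R : X → Matrix F F ℂ) {n : ℕ}
  (Q : Fin (n + 1) → X → Matrix F F ℂ) (w : F → ℂ)

omit [TopologicalSpace X] [TopologicalSpace Gt] in
/-- **Pointwise regrouping of the left-hand integrand with insertions** into the sum over index paths of
the path integrands (weighted cyclic trace formula, cyclicity, `[diag w, Q₀ R₀] = 0`): the insertion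
`Q_{t+1}` joins bond `t` on the right. [cite: Luscher1977, pp. 283–292] -/
theorem lhsIntegrand_eq_sum (hwQ : ∀ t U, Matrix.diagonal w * Q t U = Q t U * Matrix.diagonal w)
    (hw : ∀ U, Matrix.diagonal w * R U = R U * Matrix.diagonal w)
    (U : Fin (n + 1) → X) (g : Fin (n + 1) → Gt) :
    ((∏ t : Fin (n + 1), K (U t) (act (g t) (U (t + 1))) : ℝ) : ℂ) *
        ∑ s : F, w s * (List.ofFn fun t : Fin (n + 1) =>
          Q t (U t) * (R (U t) * R (U t) * Γ (g t))).prod s s =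
      ∑ s : Fin (n + 1) → F, w (s 0) * ∏ t : Fin (n + 1),
        (((K (U t) (act (g t) (U (t + 1))) : ℝ) : ℂ) *
          (R (U t) * Γ (g t) * (Q (t + 1) (U (t + 1)) * R (U (t + 1)))) (s t) (s (t + 1))) := by
  rw [sum_cyclic_regroup_insert n w (fun t => Q t (U t)) (fun t => R (U t)) (fun t => Γ (g t))
    (hwQ _ _) (hw _), Complex.ofReal_prod, Finset.mul_sum]
  refine Finset.sum_congr rfl fun s _ => ?_
  rw [Finset.prod_mul_distrib]
  ring

/-- The left-hand integrand `∏_t K(U_t, U_{t+1}^{g_t}) · Σ_s w_s (∏_t Q_t(U_t) R_t R_t Γ_t)_{ss}` is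
continuous along any continuous family `p ↦ (U(p), g(p))` of slices and temporal links. [folklore] -/
theorem continuous_lhsIntegrand (hK : Continuous fun q : X × X => K q.1 q.2)
    (hact : Continuous fun q : Gt × X => act q.1 q.2) (hΓ : Continuous Γ) (hRc : Continuous R)
    (hQc : ∀ t, Continuous (Q t))
    {u : P → Fin (n + 1) → X} {γ : P → Fin (n + 1) → Gt} (hu : Continuous u) (hγ : Continuous γ) :
    Continuous fun p => ((∏ t : Fin (n + 1), K (u p t) (act (γ p t) (u p (t + 1))) : ℝ) : ℂ) *
      ∑ s : F, w s * (List.ofFn fun t : Fin (n + 1) =>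
        Q t (u p t) * (R (u p t) * R (u p t) * Γ (γ p t))).prod s s := by
  have hut : ∀ t, Continuous fun p => u p t := fun t => (continuous_apply t).comp' hu
  have hγt : ∀ t, Continuous fun p => γ p t := fun t => (continuous_apply t).comp' hγ
  have hKc : Continuous fun p => ((∏ t : Fin (n + 1), K (u p t) (act (γ p t) (u p (t + 1))) : ℝ) : ℂ) := by
    simp only [Complex.ofReal_prod]
    exact continuous_finsetProd _ fun t _ =>
      continuous_kernel₂ K hK (hut t) (continuous_act₂ act hact (hγt t) (hut (t + 1)))
  have hL : Continuous fun p => (List.ofFn fun t : Fin (n + 1) =>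
      Q t (u p t) * (R (u p t) * R (u p t) * Γ (γ p t))).prod := by
    simp only [List.ofFn_eq_map]
    exact continuous_list_prod _ fun t _ => ((hQc t).comp' (hut t)).mul
      (((hRc.comp' (hut t)).mul (hRc.comp' (hut t))).mul (hΓ.comp' (hγt t)))
  exact hKc.mul (continuous_finsetSum _ fun s _ => continuous_const.mul (hL.matrix_elem s s))

omit [DecidableEq F] in
/-- The path integrand `w(s₀) ∏_t K(U_t, U_{t+1}^{g_t}) (R_t Γ_t (Q_{t+1} R_{t+1}))_{s_t s_{t+1}}` of a fixed
index path `s` is continuous along any continuous family `p ↦ (U(p), g(p))`. [folklore] -/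
theorem continuous_pathIntegrand (hK : Continuous fun q : X × X => K q.1 q.2)
    (hact : Continuous fun q : Gt × X => act q.1 q.2) (hΓ : Continuous Γ) (hRc : Continuous R)
    (hQc : ∀ t, Continuous (Q t))
    {u : P → Fin (n + 1) → X} {γ : P → Fin (n + 1) → Gt} (hu : Continuous u) (hγ : Continuous γ)
    (s : Fin (n + 1) → F) :
    Continuous fun p => w (s 0) * ∏ t : Fin (n + 1), (((K (u p t) (act (γ p t) (u p (t + 1))) : ℝ) : ℂ) *
      (R (u p t) * Γ (γ p t) * (Q (t + 1) (u p (t + 1)) * R (u p (t + 1)))) (s t) (s (t + 1))) := by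
  have hut : ∀ t, Continuous fun p => u p t := fun t => (continuous_apply t).comp' hu
  have hγt : ∀ t, Continuous fun p => γ p t := fun t => (continuous_apply t).comp' hγ
  exact continuous_const.mul (continuous_finsetProd _ fun t _ =>
    (continuous_kernel₂ K hK (hut t) (continuous_act₂ act hact (hγt t) (hut (t + 1)))).mul
      ((((hRc.comp' (hut t)).mul (hΓ.comp' (hγt t))).mul
        (((hQc (t + 1)).comp' (hut (t + 1))).mul (hRc.comp' (hut (t + 1))))).matrix_elem _ _))

variable [MeasurableSpace Gt] [OpensMeasurableSpace Gt] [CompactSpace Gt] [SecondCountableTopology Gt]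
  (ν : Measure Gt) [IsFiniteMeasure ν]

omit [DecidableEq F] in
/-- **The temporal-link integral of a path integrand factorises over the bonds**
(`integral_fintype_prod_eq_prod`: each `g_t` enters exactly one bond) and yields
`w(s₀) ∏_t (R_t B_t Q_{t+1} R_{t+1})_{s_t s_{t+1}}` with the averaged bond matrix `B_t`: the constant matrices
`R_t` and `Q_{t+1} R_{t+1}` come out of the entrywise average. [cite: Luscher1977, pp. 283–292] -/
theorem integral_pathIntegrand (hK : Continuous fun q : X × X => K q.1 q.2)
    (hact : Continuous fun q : Gt × X => act q.1 q.2) (hΓ : Continuous Γ)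
    (U : Fin (n + 1) → X) (s : Fin (n + 1) → F) :
    ∫ g : Fin (n + 1) → Gt, w (s 0) * ∏ t : Fin (n + 1), (((K (U t) (act (g t) (U (t + 1))) : ℝ) : ℂ) *
        (R (U t) * Γ (g t) * (Q (t + 1) (U (t + 1)) * R (U (t + 1)))) (s t) (s (t + 1)))
        ∂(Measure.pi fun _ => ν) =
      w (s 0) * ∏ t : Fin (n + 1), (R (U t) *
        (Matrix.of fun a c => ∫ g, ((K (U t) (act g (U (t + 1))) : ℝ) : ℂ) * Γ g a c ∂ν) *
          Q (t + 1) (U (t + 1)) * R (U (t + 1))) (s t) (s (t + 1)) := by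
  rw [integral_const_mul]
  congr 1
  have hprod := integral_fintype_prod_eq_prod (𝕜 := ℂ) (μ := fun _ : Fin (n + 1) => ν)
    fun (t : Fin (n + 1)) (x : Gt) => (((K (U t) (act x (U (t + 1))) : ℝ) : ℂ) *
      (R (U t) * Γ x * (Q (t + 1) (U (t + 1)) * R (U (t + 1)))) (s t) (s (t + 1)))
  rw [hprod]
  refine Finset.prod_congr rfl fun t _ => ?_
  rw [integral_mul_three_apply Γ ν hΓ _
    (continuous_kernel₂ K hK continuous_const (continuous_act₂ act hact continuous_id' continuous_const))
    _ _ _ _, Matrix.mul_assoc _ (Q (t + 1) (U (t + 1))) (R (U (t + 1)))]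

/-- **The temporal-link integral of the left-hand integrand at fixed slices** is the sum over index
paths of `w(s₀) ∏_t (R_t B_t Q_{t+1} R_{t+1})_{s_t s_{t+1}}`. [cite: Luscher1977, pp. 283–292] -/
theorem integral_lhsIntegrand (hK : Continuous fun q : X × X => K q.1 q.2)
    (hact : Continuous fun q : Gt × X => act q.1 q.2) (hΓ : Continuous Γ) (hRc : Continuous R)
    (hQc : ∀ t, Continuous (Q t))
    (hwQ : ∀ t U, Matrix.diagonal w * Q t U = Q t U * Matrix.diagonal w)
    (hw : ∀ U, Matrix.diagonal w * R U = R U * Matrix.diagonal w) (U : Fin (n + 1) → X) :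
    ∫ g : Fin (n + 1) → Gt, ((∏ t : Fin (n + 1), K (U t) (act (g t) (U (t + 1))) : ℝ) : ℂ) *
        ∑ s : F, w s * (List.ofFn fun t : Fin (n + 1) =>
          Q t (U t) * (R (U t) * R (U t) * Γ (g t))).prod s s ∂(Measure.pi fun _ => ν) =
    ∑ s : Fin (n + 1) → F, w (s 0) * ∏ t : Fin (n + 1), (R (U t) *
      (Matrix.of fun a c => ∫ g, ((K (U t) (act g (U (t + 1))) : ℝ) : ℂ) * Γ g a c ∂ν) *
        Q (t + 1) (U (t + 1)) * R (U (t + 1))) (s t) (s (t + 1)) := by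
  simp_rw [lhsIntegrand_eq_sum K act Γ R Q w hwQ hw U]
  rw [integral_finsetSum _ fun s _ => integrable_of_continuous
    (continuous_pathIntegrand (u := fun _ => U) (γ := fun g => g) K act Γ R Q w hK hact hΓ hRc hQc
      continuous_const continuous_id' s)]
  exact Finset.sum_congr rfl fun s _ => integral_pathIntegrand K act Γ R Q w ν hK hact hΓ U s

variable [MeasurableSpace X] [OpensMeasurableSpace X] [CompactSpace X] [SecondCountableTopology X]
  (μ : Measure X) [IsFiniteMeasure μ] [MeasurableSpace F] [MeasurableSingletonClass F]

omit [DecidableEq F] in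
/-- **Integrability of the right-hand (cyclic) integrand with insertions** on `(slices) × (index paths)`:
each section at a fixed path is the temporal-link integral (`integral_pathIntegrand`) of a continuous
function on a compact space (`Integrable.integral_prod_left`), and the path space is finite. [folklore] -/
theorem integrable_rhsIntegrand (hK : Continuous fun q : X × X => K q.1 q.2)
    (hact : Continuous fun q : Gt × X => act q.1 q.2) (hΓ : Continuous Γ) (hRc : Continuous R)
    (hQc : ∀ t, Continuous (Q t)) :
    Integrable (fun q : (Fin (n + 1) → X) × (Fin (n + 1) → F) =>
      w (q.2 0) * ∏ t : Fin (n + 1), (R (q.1 t) *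
        (Matrix.of fun a c => ∫ g, ((K (q.1 t) (act g (q.1 (t + 1))) : ℝ) : ℂ) * Γ g a c ∂ν) *
          Q (t + 1) (q.1 (t + 1)) * R (q.1 (t + 1))) (q.2 t) (q.2 (t + 1)))
      ((Measure.pi fun _ : Fin (n + 1) => μ).prod
        (Measure.pi fun _ : Fin (n + 1) => (Measure.count : Measure F))) := by
  have hcont := fun s => continuous_pathIntegrand (P := (Fin (n + 1) → X) × (Fin (n + 1) → Gt))
    K act Γ R Q w hK hact hΓ hRc hQc continuous_fst continuous_snd s
  refine (integrable_prod_iff' ?_).2 ⟨Filter.Eventually.of_forall fun s => ?_, Integrable.of_finite⟩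
  · refine (measurable_from_prod_countable_left fun s => ?_).aestronglyMeasurable
    dsimp only
    simp_rw [← integral_pathIntegrand K act Γ R Q w ν hK hact hΓ]
    exact ((hcont s).stronglyMeasurable.integral_prod_right'
      (ν := Measure.pi fun _ : Fin (n + 1) => ν)).measurable
  · simp_rw [← integral_pathIntegrand K act Γ R Q w ν hK hact hΓ]
    exact (integrable_of_continuous (μ := (Measure.pi fun _ : Fin (n + 1) => μ).prod
      (Measure.pi fun _ : Fin (n + 1) => ν)) (hcont s)).integral_prod_left

/-- **The stub in abstract form, over `Fin (n+1)`, with a general diagonal weight `w` and slot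
insertions `Q t`**: both sides equal `∫ Σ_s w(s₀) ∏_t (R_t B_t Q_{t+1} R_{t+1})_{s_t s_{t+1}} dU`
(left: Fubini and `integral_lhsIntegrand`; right: `(Fin N → X × F) ≃ (Fin N → X) × (Fin N → F)`, Fubini,
`pi count = count`). [cite: Luscher1977, pp. 283–292] [cite: MontvayMunster1994, §4.1.3 (4.34)] -/
theorem main_fin (hK : Continuous fun q : X × X => K q.1 q.2)
    (hact : Continuous fun q : Gt × X => act q.1 q.2) (hΓ : Continuous Γ) (hRc : Continuous R)
    (hQc : ∀ t, Continuous (Q t))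
    (hwQ : ∀ t U, Matrix.diagonal w * Q t U = Q t U * Matrix.diagonal w)
    (hw : ∀ U, Matrix.diagonal w * R U = R U * Matrix.diagonal w) :
    (∫ p : (Fin (n + 1) → X) × (Fin (n + 1) → Gt),
        ((∏ t : Fin (n + 1), K (p.1 t) (act (p.2 t) (p.1 (t + 1))) : ℝ) : ℂ) *
          ∑ s : F, w s * (List.ofFn fun t : Fin (n + 1) =>
            Q t (p.1 t) * (R (p.1 t) * R (p.1 t) * Γ (p.2 t))).prod s s
        ∂((Measure.pi fun _ : Fin (n + 1) => μ).prod (Measure.pi fun _ : Fin (n + 1) => ν))) =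
      ∫ V : Fin (n + 1) → X × F, w (V 0).2 * ∏ t : Fin (n + 1), (R (V t).1 *
          (Matrix.of fun a c => ∫ g, ((K (V t).1 (act g (V (t + 1)).1) : ℝ) : ℂ) * Γ g a c ∂ν) *
            Q (t + 1) (V (t + 1)).1 * R (V (t + 1)).1) (V t).2 (V (t + 1)).2
        ∂(Measure.pi fun _ => μ.prod Measure.count) := by
  rw [integral_prod _ (integrable_of_continuous  -- left: Fubini, then `integral_lhsIntegrand`
    (continuous_lhsIntegrand K act Γ R Q w hK hact hΓ hRc hQc continuous_fst continuous_snd))]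
  dsimp only
  simp_rw [integral_lhsIntegrand K act Γ R Q w ν hK hact hΓ hRc hQc hwQ hw]
  symm  -- right: split `(Fin N → X × F)` into `(Fin N → X) × (Fin N → F)`, Fubini, count the paths
  refine ((measurePreserving_arrowProdEquivProdArrow X F (Fin (n + 1)) (fun _ => μ)
    (fun _ => (Measure.count : Measure F))).integral_comp'
      (fun q : (Fin (n + 1) → X) × (Fin (n + 1) → F) =>
        w (q.2 0) * ∏ t : Fin (n + 1), (R (q.1 t) *
          (Matrix.of fun a c => ∫ g, ((K (q.1 t) (act g (q.1 (t + 1))) : ℝ) : ℂ) * Γ g a c ∂ν) *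
            Q (t + 1) (q.1 (t + 1)) * R (q.1 (t + 1))) (q.2 t) (q.2 (t + 1)))).trans ?_
  rw [integral_prod _ (integrable_rhsIntegrand K act Γ R Q w ν μ hK hact hΓ hRc hQc)]
  simp only [integral_pi_count]

end Abstract

end StubCyclicScalariseInsert

/-- **δ1 of E2 (registered stub `stub_cyclic_scalarise_insert` of line `pin-the-infimum`): scalarisation
of the configuration-space cyclic supertrace WITH fibrewise slot insertions.**  For any continuous
pointwise square root `R(U)² = T̂_F(U)` commuting with the fermion parity `Π = diag((−1)^{#s})`, any
continuous link-free insertions `Q_i(U)` commuting with `Π`, the Gauss-averaged bond matrix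
`B(U,U')_{a c} = ∫ K_β(U, U'^g) Γ(G_g)_{a c} dg` on `SU(3)^{E₃} × Finset(modes)` (measure `Haar ⊗ count`):
`∫∫ ∏_t K_β(U_t, U_{t+1}^{g_t}) · Σ_s (−1)^{#s} (∏_i Q_i(U_i) T̂_F(U_i) Γ(G_{g_i}))_{ss} dU dg`
`  = ∫ (−1)^{#(V 0).2} ∏_{t : Fin N} (R((V t).1) B((V t).1, (V (t+1)).1) Q_{t+1}((V (t+1)).1) R((V (t+1)).1))_{(V t).2 (V (t+1)).2} dV`:
the insertion in front of slice `i` lands inside the bond kernel entering slice `i`, between `B` and `R`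
(`N = n + 1`, `ZMod (n+1) = Fin (n+1)`, `T̂_F = R R`, and `StubCyclicScalariseInsert.main_fin` at
`w = (−1)^{#s}`, `Q t := Q (t : ℕ)`). [cite: Luscher1977, pp. 283–292] [cite: MontvayMunster1994, §4.1.3 (4.34)] -/
theorem stub_cyclic_scalarise_insert : ∀ (Nf N : ℕ) [NeZero N] (β : ℝ) (mq : Fin Nf → ℝ) (R : GaugeConfig 3 N (Matrix.specialUnitaryGroup (Fin 3) ℂ) → Matrix (Finset (SliceFermiIdx Nf N)) (Finset (SliceFermiIdx Nf N)) ℂ) (Q : ℕ → GaugeConfig 3 N (Matrix.specialUnitaryGroup (Fin 3) ℂ) → Matrix (Finset (SliceFermiIdx Nf N)) (Finset (SliceFermiIdx Nf N)) ℂ), Continuous R → (∀ U, R U * R U = fermionSliceOp U mq) → (∀ U, Matrix.diagonal (fun s : Finset (SliceFermiIdx Nf N) => (-1 : ℂ) ^ s.card) * R U = R U * Matrix.diagonal (fun s : Finset (SliceFermiIdx Nf N) => (-1 : ℂ) ^ s.card)) → (∀ i, Continuous (Q i)) → (∀ i U, Matrix.diagonal (fun s : Finset (SliceFermiIdx Nf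 N) => (-1 : ℂ) ^ s.card) * Q i U = Q i U * Matrix.diagonal (fun s : Finset (SliceFermiIdx Nf N) => (-1 : ℂ) ^ s.card)) → (∫ p : (ZMod N → GaugeConfig 3 N (Matrix.specialUnitaryGroup (Fin 3) ℂ)) × (ZMod N → TorusSite 3 N → Matrix.specialUnitaryGroup (Fin 3) ℂ), ((∏ t : ZMod N, gaugeSliceKernel β (p.1 t) (gaugeTransform (p.2 t) (p.1 (t + 1))) : ℝ) : ℂ) * ∑ s : Finset (SliceFermiIdx Nf N), (-1 : ℂ) ^ s.card * (((List.range N).map fun i : ℕ => Q i (p.1 (i : ZMod N)) * (fermionSliceOp (p.1 (i : ZMod N)) mq * fockGaugeAct (Nf := Nf) (p.2 (i : ZMod N)))).prod) s s ∂((Measure.pi fun _ : ZMod N => Measure.pi fun _ : Edge 3 N => haarProbability (Matrix.specialUnitaryGroup (Fin 3) ℂ)).prod (Measure.pi fun _ : ZMod N => Measure.pi fun _ : TorusSite 3 N => haarProbability (Matrix.specialUnitaryGroup (Fin 3) ℂ)))) = ∫ V : Fin N → GaugeConfig 3 N (Matrix.specialUnitaryGroup (Fin 3) ℂ) × Finset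 (SliceFermiIdx Nf N), (-1 : ℂ) ^ (V 0).2.card * ∏ t : Fin N, (R (V t).1 * (Matrix.of fun a c => ∫ g : TorusSite 3 N → Matrix.specialUnitaryGroup (Fin 3) ℂ, (gaugeSliceKernel β (V t).1 (gaugeTransform g (V (t + 1)).1) : ℂ) * fockGaugeAct (Nf := Nf) g a c ∂(Measure.pi fun _ => haarProbability (Matrix.specialUnitaryGroup (Fin 3) ℂ))) * Q ((t + 1 : Fin N) : ℕ) (V (t + 1)).1 * R (V (t + 1)).1) (V t).2 (V (t + 1)).2 ∂(Measure.pi fun _ => (sliceHaar N).prod Measure.count) := by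
  intro Nf N _ β mq R Q hRc hR2 hP hQc hQP
  obtain ⟨n, rfl⟩ : ∃ n, N = n + 1 := ⟨N - 1, (Nat.succ_pred_eq_of_ne_zero (NeZero.ne N)).symm⟩
  simp only [StubCyclicScalarise.range_map_eq_ofFn, StubCyclicScalarise.natCast_zmod_fin, ← hR2]
  exact StubCyclicScalariseInsert.main_fin (gaugeSliceKernel β) gaugeTransform (fockGaugeAct (Nf := Nf)) R
    (fun t : Fin (n + 1) => Q (t : ℕ)) (fun s => (-1 : ℂ) ^ s.card)
    (Measure.pi fun _ : TorusSite 3 (n + 1) => haarProbability (Matrix.specialUnitaryGroup (Fin 3) ℂ))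
    (Measure.pi fun _ : Edge 3 (n + 1) => haarProbability (Matrix.specialUnitaryGroup (Fin 3) ℂ))
    (StableActionBridge.Sketch.continuous_gaugeSliceKernel (n + 1) β) continuous_gaugeTransform_prod
    StubCyclicScalarise.continuous_fockGaugeAct hRc (fun t => hQc t) (fun t U => hQP t U) hP

end Summit.QuantumFields.QCD.Cruxes.RobustYangMillsHandover.PinTheInfimum

end
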